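import Summits.HodgeConjecture.Ring2.NonSimpleFivefoldsRows
import Summits.HodgeConjecture.CorCM.CMAbelianFivefoldPowers
import HarnessLib

/-!
# Non-simple complex abelian FIVEFOLDS, part 2: Moonen–Zarhin 1999 Thm. 0.2 (4) («no simple factor of dimension 4, outside (e), (f), (g) ⟹ `B•(Xⁿ) = D•(Xⁿ)`») — the union of the tree's rows with the CorCM classification, the two all-Type-IV non-CM rows of (5.10)–(5.11) displayed

Cell `pub-hodge-ring2` (HONEST FRAMING: research route conditional on HC_CM; not a corollary; Q11.4-sentence-2 already
refuted in dim ≥ 3), Literature lane (lit seat, generation 59, programme R27, part 2; part 1 = `Ring2/NonSimpleFivefoldsRows`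
quotes the published statement and proof plan, Math. Ann. 315 (1999) Thm. 0.2 and §5 (5.6)–(5.11) [corpus:
paper:arxiv-math_9901113 chunks p0001 L127–L171, p0002 L1–L14, p0009 L110–p0010 L90]). Theorems only (no definition, no
named fact, no `sorry`); NOTHING here assumes HC_CM. NEW as stated, hence under `Summits/`. Further rows used BY NAME:
the complete row `E × T`, `T` SIMPLE, outside (a) (`isStablyNondegenerate_curve_prod_of_isSimple_threefold`; Prop. (3.8),
R21/R23/R24); `A × C`, `A` without factor of Type IV, `C` of CM type (`IsStablyNondegenerate.prod_of_hasNoTypeIVFactor_of_isOfCMType`;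
Thm. (3.2)(2), R5); dimension `≤ 3` (R20); and, for `X` OF CM TYPE, `CorCM.isDivisorGenerated_of_avDominatedBy_powSucc_of_isOfCMType_of_dim_le_five`.
DISPLAYED, relative to `X` (not theorems of the tree; the published proofs use Lemma (3.6) / Prop. (3.8) for a cofactor
whose Hodge group has a centre of rank two): (5.10) `S × T` for `S` a simple CM surface and `T` a simple threefold of
Type IV NOT of CM type (`hST`); (5.11) `E₁ × E₂ × T` for two non-isogenous CM elliptic curves and such a `T` admitting
neither `End⁰(Eᵢ)` (`hEET`). «Type IV, not of CM type» is rendered `¬ HasNoTypeIVFactor T ∧ ¬ IsOfCMType T`. Case (g)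
and the simple fivefolds (Tankeev; the tree's FACT `TankeevRibet1983_hodgeClasses_divisorial_powers_simplePrimeDimension`)
are outside the file: `X` is non-simple with no simple isogeny factor of dimension `4` («no simple factor of dimension 4»).

RESULTS (`X E E' E₁ E₂ T S S₁ S₂ Y Z : AbelianVariety ℂ`):
* §2 (continued) `isStablyNondegenerate_curve_prod_curve_prod_threefold_of_not_isOfCMType_of` (displays `hEET`),
  `…_curve_prod_fourfold_of_not_isSimple_of_not_isOfCMType_of`.
* §3 **`isStablyNondegenerate_of_dim_eq_five_of_not_isSimple_of`** `(hX5 : X.dim = 5) (hX : ¬ X.IsSimple) (h4 : no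
  simple fourfold isogeny factor) (hna : ¬ (e)/(f)) (hST) (hEET) : IsStablyNondegenerate X`, its non-CM half
  `…_of_not_isOfCMType_of`, and `hodgeConjectureFor_powSucc_of_dim_eq_five_of_not_isSimple_of`.
* §4 HYPOTHESIS-FREE SHAPES: **every `E × (S₁ × S₂)`** (`isStablyNondegenerate_curve_prod_surface_prod_surface`; in print
  for the product itself Ramón Marí 2008 Prop. 2.18, `r = 3`), **every `E × (E' × T)` and `S × T` with `T` a NON-SIMPLE
  threefold**, every non-simple fivefold whose simple isogeny factors have dimension `≤ 2`
  (`isStablyNondegenerate_of_dim_eq_five_of_forall_factor_dim_le_two`; all dimensions `≤ 5` combined: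
  **`isStablyNondegenerate_of_dim_le_five_of_forall_factor_dim_le_two`**), **`E × Z` for `E` WITHOUT complex multiplication
  and `Z` ANY non-simple fourfold outside case (a)** (`isStablyNondegenerate_nonCMCurve_prod_fourfold_of_not_isSimple`) —
  and the Hodge conjecture for all powers of each, UNCONDITIONALLY.
EXACT RESIDUAL of Thm. 0.2 (4) for non-simple fivefolds after this file: the displayed rows (5.10) `S_F × T` and (5.11)
`E_k × E_{k'} × T`, `T` a simple threefold of Type IV not of CM type — Lemma (3.6) / Prop. (3.8) for cofactors with a
rank-two centre (the tree's Prop. (3.8) rows: `CMCurveTimesSimpleCMVarietyDichotomy`, `RankOneCentreTimesCMCurveProductSpan`,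
`NoTypeIVTimesCMStablyNondegenerate`).

## References
* [MoonenZarhin1999LowDim] B. Moonen, Yu. Zarhin, Math. Ann. 315 (1999) 711–733: Thm. 0.2 (4), Thm. (3.2), Lemmas
  (3.4), (3.6), Prop. (3.8), §5 (5.6)–(5.11) [corpus: paper:arxiv-math_9901113]. [cite: MoonenZarhin1999LowDim, Thm. 0.2 (4) and §5 (5.6)–(5.11)]
* [MumfordAV1970] D. Mumford, *Abelian Varieties* (1970), §19 Thm. 1 and Cor. 1–2 (pp. 173–174). [cite: MumfordAV1970, §19 Thm. 1 (pp. 173–174)]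
* [vanGeemen1994HodgeAV] B. van Geemen, LNM 1594 (1994), §3.6, Lemma 3.7. [cite: vanGeemen1994HodgeAV, Lemma 3.7 and §3.6]
* [Milne1999] J. S. Milne, Compositio Math. 117 (1999), §2 p. 54. [cite: Milne1999, §2 p. 54]
* [RamonMari2008] J. J. Ramón Marí, Collect. Math. 59 (2008), Prop. 2.18 [corpus: paper:arxiv-math_0505357 p0006]. [cite: RamonMari2008, Prop. 2.18]
-/

noncomputable section

open CategoryTheory CategoryTheory.Limits

namespace Summit.HodgeConjecture.Ring2.NonSimpleFivefolds

open Literature.AlgebraicGeometry.Motives (AbelianVariety)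
open Literature.AlgebraicGeometry.Motives.AbelianVariety
open Literature.AlgebraicGeometry.HodgeTheory
open Literature.AlgebraicGeometry.Milne1999
open Summit.HodgeConjecture.CorCM
open Summit.HodgeConjecture.CorCM.Domination
open Summit.HodgeConjecture.Ring2.NonSimpleFourfolds

variable {X Y Z E E' E₁ E₂ E₃ E₄ E₅ T S S₁ S₂ : AbelianVariety ℂ}

/-! ### §2 (continued) The rows with a simple threefold factor -/

/-- **`E × (E' × T)` for two elliptic curves and a threefold `T`, the product NOT of CM type and outside (e)/(f), is
stably nondegenerate — GIVEN the row (5.11) `E₁ × E₂ × T`** (displayed as `hEET`, relative to `E × (E' × T)`: two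
non-isogenous CM curves, `T` simple of Type IV not of CM type admitting neither field). `T` non-simple: `T ∼ E'' × S` and
the four-piece theorem; `T` simple: `E ∼ E'` ⟹ `X ∼ E² × T`, mixed powers of the complete row `E × T` (Prop. (3.8));
`Hom(E', E) = 0` and `E` non-CM ⟹ the `A × E` row over `E' × T`; `E` CM, `E'` non-CM ⟹ the same with the roles
exchanged; both CM ⟹ `T` without factor of Type IV: Thm. (3.2)(2) with `C = E × E'`; `T` CM: the product would be CM;
else `hEET`. [cite: MoonenZarhin1999LowDim, §5 (5.6)–(5.9), (5.11), Thm. (3.2)(2), Lemma (3.4), Prop. (3.8)]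
[cite: Milne1999, §2 p. 54] -/
theorem isStablyNondegenerate_curve_prod_curve_prod_threefold_of_not_isOfCMType_of (hE : E.dim = 1) (hE' : E'.dim = 1)
    (hT3 : T.dim = 3) (hcm : ¬ IsOfCMType (E.prod (E'.prod T)))
    (hna : ¬ ∃ E₀ T₀ : AbelianVariety ℂ, E₀.dim = 1 ∧ IsOfCMType E₀ ∧ T₀.IsSimple ∧ T₀.dim = 3 ∧
      AVDominatedBy E₀ (E.prod (E'.prod T)) ∧ AVDominatedBy T₀ (E.prod (E'.prod T)) ∧
      Nonempty (E₀.endAlgebra →+* T₀.endAlgebra))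
    (hEET : ∀ E₁ E₂ T₀ : AbelianVariety ℂ, E₁.dim = 1 → E₂.dim = 1 → IsOfCMType E₁ → IsOfCMType E₂ →
      ¬ AbelianVariety.IsIsogenous E₁ E₂ → T₀.dim = 3 → T₀.IsSimple → ¬ IsOfCMType T₀ → ¬ HasNoTypeIVFactor T₀ →
      IsEmpty (E₁.endAlgebra →+* T₀.endAlgebra) → IsEmpty (E₂.endAlgebra →+* T₀.endAlgebra) →
      AbelianVariety.IsIsogenous (E₁.prod (E₂.prod T₀)) (E.prod (E'.prod T)) →
      IsStablyNondegenerate (E₁.prod (E₂.prod T₀))) :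
    IsStablyNondegenerate (E.prod (E'.prod T)) := by
  have hEs : E.IsSimple := isSimple_of_dim_le_one hE.le
  have hE's : E'.IsSimple := isSimple_of_dim_le_one hE'.le
  by_cases hT : T.IsSimple
  swap
  · -- `T ∼ E'' × S`: four pieces
    obtain ⟨E'', S, hE'', hS2, hTiso⟩ := exists_curve_prod_surface_isIsogenous_of_not_isSimple_threefold hT3 hT
    have hrel : AbelianVariety.IsIsogenous (E.prod (E'.prod (E''.prod S))) (E.prod (E'.prod T)) :=
      (AbelianVariety.IsIsogenous.refl E).prod ((AbelianVariety.IsIsogenous.refl E').prod hTiso)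
    exact (isStablyNondegenerate_curve_prod_curve_prod_curve_prod_surface_of_not_isOfCMType hE hE' hE'' hS2
      (fun h => hcm ((isOfCMType_iff_of_isIsogenous hrel).1 h))).of_isIsogenous' hrel
  -- `T` simple; the dominations used for «not (e)/(f)»
  have hEX : AVDominatedBy E (E.prod (E'.prod T)) := SliceExhaustion.avDominatedBy_prod_left E _
  have hE'X : AVDominatedBy E' (E.prod (E'.prod T)) :=
    (SliceExhaustion.avDominatedBy_prod_left E' T).trans (avDominatedBy_prod_right E _)
  have hTX : AVDominatedBy T (E.prod (E'.prod T)) := (avDominatedBy_prod_right E' T).trans (avDominatedBy_prod_right E _)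
  have hET : IsStablyNondegenerate (E.prod T) :=
    isStablyNondegenerate_curve_prod_of_isSimple_threefold hE hT hT3
      (isEmpty_ringHom_of_not_exists_caseEF hE hT hT3 hEX hTX hna)
  have hE'T : IsStablyNondegenerate (E'.prod T) :=
    isStablyNondegenerate_curve_prod_of_isSimple_threefold hE' hT hT3
      (isEmpty_ringHom_of_not_exists_caseEF hE' hT hT3 hE'X hTX hna)
  by_cases hE'E : ∀ f : E' ⟶ E, f = 0
  swap
  · -- `E' ∼ E`: `X ∼ E² × T`
    push Not at hE'E
    obtain ⟨f, hf⟩ := hE'E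
    have hiso := isIsogenous_of_hom_ne_zero_of_curves hE' hE hf
    have hD : IsStablyNondegenerate ((E.powSucc 1).prod (T.powSucc 0)) := hET.powSucc_prod_powSucc 1 0
    change IsStablyNondegenerate ((E.prod E).prod T) at hD
    exact (hD.of_isIsogenous' (isIsogenous_prod_assoc E E T)).of_isIsogenous
      ((AbelianVariety.IsIsogenous.refl E).prod (hiso.prod (AbelianVariety.IsIsogenous.refl T)))
  have hTE : ∀ g : T ⟶ E, g = 0 := hom_eq_zero_of_isSimple_of_dim_ne hT hEs (by omega)
  by_cases hEcm : IsOfCMType E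
  swap
  · -- `E` non-CM, `Hom(E' × T, E) = 0`
    exact (hE'T.prod_nonCMCurve_of_forall_hom_eq_zero hE (finrank_endAlgebra_eq_one_of_curve_of_not_isOfCMType hE hEcm)
      (prod_hom_eq_zero_of_forall hE'E hTE)).of_isIsogenous' (isIsogenous_prod_comm _ E)
  by_cases hE'cm : IsOfCMType E'
  swap
  · -- `E` CM, `E'` non-CM: `Hom(E × T, E') = 0`, the row over `E × T`, then `(E × T) × E' ∼ E × (E' × T)`
    have hEE' : ∀ g : E ⟶ E', g = 0 := fun g => by
      by_contra hg
      exact hE'cm ((isOfCMType_iff_of_isIsogenous (isIsogenous_of_hom_ne_zero_of_curves hE hE' hg)).1 hEcm)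
    have hTE' : ∀ g : T ⟶ E', g = 0 := hom_eq_zero_of_isSimple_of_dim_ne hT hE's (by omega)
    exact ((hET.prod_nonCMCurve_of_forall_hom_eq_zero hE' (finrank_endAlgebra_eq_one_of_curve_of_not_isOfCMType hE' hE'cm)
      (prod_hom_eq_zero_of_forall hEE' hTE')).of_isIsogenous' (isIsogenous_prod_assoc E T E')).of_isIsogenous'
      ((AbelianVariety.IsIsogenous.refl E).prod (isIsogenous_prod_comm T E'))
  -- both curves of CM type, not isogenous
  have hniso : ¬ AbelianVariety.IsIsogenous E E' := by
    rintro ⟨g, hg⟩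
    obtain ⟨g', hg'⟩ := (AbelianVariety.IsIsogenous.symm' ⟨g, hg⟩ : AbelianVariety.IsIsogenous E' E)
    exact not_isIsogeny_zero_of_dim_pos (X := E') (Y := E) (by omega) (hE'E g' ▸ hg')
  by_cases hT4 : HasNoTypeIVFactor T
  · -- `T` without factor of Type IV: Thm. (3.2)(2) with `C = E × E'`
    have hTD : IsStablyNondegenerate T := isStablyNondegenerate_of_dim_pos_of_dim_le_three (by omega) hT3.le
    have hCD : IsStablyNondegenerate (E.prod E') :=
      isStablyNondegenerate_of_dim_pos_of_dim_le_three (by rw [dim_prod]; omega) (by rw [dim_prod]; omega)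
    exact ((hTD.prod_of_hasNoTypeIVFactor_of_isOfCMType hT4 (hEcm.prod hE'cm) hCD).of_isIsogenous'
      (isIsogenous_prod_comm T _)).of_isIsogenous' (isIsogenous_prod_assoc E E' T)
  by_cases hTcm : IsOfCMType T
  · exact absurd (hEcm.prod (hE'cm.prod hTcm)) hcm
  exact hEET E E' T hE hE' hEcm hE'cm hniso hT3 hT hTcm hT4
    (isEmpty_ringHom_of_not_exists_caseEF hE hT hT3 hEX hTX hna hEcm)
    (isEmpty_ringHom_of_not_exists_caseEF hE' hT hT3 hE'X hTX hna hE'cm) (AbelianVariety.IsIsogenous.refl _)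

/-- **`E × Z` for an elliptic curve `E` and a NON-SIMPLE abelian fourfold `Z`, the product NOT of CM type and outside
(e)/(f), is stably nondegenerate — GIVEN the row (5.11)** (`hEET`, relative to `E × Z`). `Z ∼ E' × T` or `Z ∼ S₁ × S₂`
(Poincaré, gen 58) and the previous theorems. [cite: MoonenZarhin1999LowDim, §5 (5.6)–(5.9), (5.11)] [cite: MumfordAV1970, §19 Thm. 1 (pp. 173–174)] -/
theorem isStablyNondegenerate_curve_prod_fourfold_of_not_isSimple_of_not_isOfCMType_of (hE : E.dim = 1)
    (hZ4 : Z.dim = 4) (hZ : ¬ Z.IsSimple) (hcm : ¬ IsOfCMType (E.prod Z))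
    (hna : ¬ ∃ E₀ T₀ : AbelianVariety ℂ, E₀.dim = 1 ∧ IsOfCMType E₀ ∧ T₀.IsSimple ∧ T₀.dim = 3 ∧
      AVDominatedBy E₀ (E.prod Z) ∧ AVDominatedBy T₀ (E.prod Z) ∧ Nonempty (E₀.endAlgebra →+* T₀.endAlgebra))
    (hEET : ∀ E₁ E₂ T₀ : AbelianVariety ℂ, E₁.dim = 1 → E₂.dim = 1 → IsOfCMType E₁ → IsOfCMType E₂ →
      ¬ AbelianVariety.IsIsogenous E₁ E₂ → T₀.dim = 3 → T₀.IsSimple → ¬ IsOfCMType T₀ → ¬ HasNoTypeIVFactor T₀ →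
      IsEmpty (E₁.endAlgebra →+* T₀.endAlgebra) → IsEmpty (E₂.endAlgebra →+* T₀.endAlgebra) →
      AbelianVariety.IsIsogenous (E₁.prod (E₂.prod T₀)) (E.prod Z) → IsStablyNondegenerate (E₁.prod (E₂.prod T₀))) :
    IsStablyNondegenerate (E.prod Z) := by
  obtain ⟨Y', Z', hdims, hiso⟩ := exists_prod_isIsogenous_of_not_isSimple_fourfold hZ4 hZ
  have hrel : AbelianVariety.IsIsogenous (E.prod (Y'.prod Z')) (E.prod Z) := (AbelianVariety.IsIsogenous.refl E).prod hiso
  obtain ⟨g, hg⟩ := hrel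
  have hcm' : ¬ IsOfCMType (E.prod (Y'.prod Z')) := fun h => hcm ((isOfCMType_iff_of_isIsogenous ⟨g, hg⟩).1 h)
  rcases hdims with ⟨hY1, hZ3⟩ | ⟨hY2, hZ2⟩
  · refine (isStablyNondegenerate_curve_prod_curve_prod_threefold_of_not_isOfCMType_of hE hY1 hZ3 hcm' ?_ ?_).of_isIsogenous' ⟨g, hg⟩
    · rintro ⟨E₀, T₀, h₀, hc₀, hTs, hT3, hE₀, hT₀, hne⟩
      exact hna ⟨E₀, T₀, h₀, hc₀, hTs, hT3, hE₀.trans_isIsogeny_hom hg, hT₀.trans_isIsogeny_hom hg, hne⟩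
    · intro E₁ E₂ T₀ h₁ h₂ c₁ c₂ hni hT3 hTs hTc hT4 i₁ i₂ hW
      exact hEET E₁ E₂ T₀ h₁ h₂ c₁ c₂ hni hT3 hTs hTc hT4 i₁ i₂ (hW.trans ⟨g, hg⟩)
  · exact (isStablyNondegenerate_curve_prod_surface_prod_surface_of_not_isOfCMType hE hY2 hZ2 hcm').of_isIsogenous' ⟨g, hg⟩

/-! ### §3 Moonen–Zarhin Thm. 0.2 (4) for non-simple fivefolds -/

/-- **MOONEN–ZARHIN Thm. 0.2 (4) FOR NON-SIMPLE FIVEFOLDS NOT OF CM TYPE, the rows (5.10)–(5.11) displayed.** Let `X` be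
a non-simple complex abelian fivefold, not of CM type, with no simple isogeny factor of dimension `4` (`h4`), outside the
cases (e)/(f) (`hna`: no elliptic curve `E` of CM type and simple threefold `T`, both isogeny factors of `X`, with
`End⁰(E) ↪ End⁰(T)`), and grant the two rows `hST`, `hEET` (relative to `X`). Then `B•(Xⁿ) = D•(Xⁿ)` for all `n`.
Proof: §1, then §2 on `X ∼ E × Z` / `X ∼ S × T` (a non-simple surface or threefold factor is split further, so that an
elliptic factor appears). [cite: MoonenZarhin1999LowDim, Thm. 0.2 (4) and §5 (5.6)–(5.11)] [cite: MumfordAV1970, §19 Thm. 1 (pp. 173–174)] -/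
theorem isStablyNondegenerate_of_dim_eq_five_of_not_isSimple_of_not_isOfCMType_of (hX5 : X.dim = 5)
    (hX : ¬ X.IsSimple) (hcm : ¬ IsOfCMType X)
    (h4 : ∀ F : AbelianVariety ℂ, F.IsSimple → F.dim = 4 → ¬ AVDominatedBy F X)
    (hna : ¬ ∃ E T : AbelianVariety ℂ, E.dim = 1 ∧ IsOfCMType E ∧ T.IsSimple ∧ T.dim = 3 ∧
      AVDominatedBy E X ∧ AVDominatedBy T X ∧ Nonempty (E.endAlgebra →+* T.endAlgebra))
    (hST : ∀ S T : AbelianVariety ℂ, S.dim = 2 → S.IsSimple → IsOfCMType S → T.dim = 3 → T.IsSimple →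
      ¬ IsOfCMType T → ¬ HasNoTypeIVFactor T → AbelianVariety.IsIsogenous (S.prod T) X → IsStablyNondegenerate (S.prod T))
    (hEET : ∀ E₁ E₂ T : AbelianVariety ℂ, E₁.dim = 1 → E₂.dim = 1 → IsOfCMType E₁ → IsOfCMType E₂ →
      ¬ AbelianVariety.IsIsogenous E₁ E₂ → T.dim = 3 → T.IsSimple → ¬ IsOfCMType T → ¬ HasNoTypeIVFactor T →
      IsEmpty (E₁.endAlgebra →+* T.endAlgebra) → IsEmpty (E₂.endAlgebra →+* T.endAlgebra) →
      AbelianVariety.IsIsogenous (E₁.prod (E₂.prod T)) X → IsStablyNondegenerate (E₁.prod (E₂.prod T))) :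
    IsStablyNondegenerate X := by
  -- the `E × Z` handler, for any isogeny `E × Z → X` with `Z` a non-simple fourfold
  have H : ∀ E Z : AbelianVariety ℂ, E.dim = 1 → Z.dim = 4 → ¬ Z.IsSimple →
      AbelianVariety.IsIsogenous (E.prod Z) X → IsStablyNondegenerate X := by
    intro E Z hE hZ4 hZ hrel
    obtain ⟨g, hg⟩ := hrel
    refine (isStablyNondegenerate_curve_prod_fourfold_of_not_isSimple_of_not_isOfCMType_of hE hZ4 hZ
      (fun h => hcm ((isOfCMType_iff_of_isIsogenous ⟨g, hg⟩).1 h))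
      (not_exists_caseEF_of_avDominatedBy ((AVDominatedBy.refl _).trans_isIsogeny_hom hg) hna) ?_).of_isIsogenous' ⟨g, hg⟩
    intro E₁ E₂ T₀ h₁ h₂ c₁ c₂ hni hT3 hTs hTc hT4 i₁ i₂ hW
    exact hEET E₁ E₂ T₀ h₁ h₂ c₁ c₂ hni hT3 hTs hTc hT4 i₁ i₂ (hW.trans ⟨g, hg⟩)
  obtain ⟨Y, Z, hdims, hiso⟩ := exists_prod_isIsogenous_of_not_isSimple_fivefold hX5 hX
  obtain ⟨g, hg⟩ := hiso
  rcases hdims with ⟨hY1, hZ4⟩ | ⟨hY2, hZ3⟩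
  · -- `X ∼ E × Z`
    by_cases hZ : Z.IsSimple
    · exact absurd ((avDominatedBy_prod_right Y Z).trans_isIsogeny_hom hg) (h4 Z hZ hZ4)
    · exact H Y Z hY1 hZ4 hZ ⟨g, hg⟩
  · -- `X ∼ S × T`
    by_cases hYs : Y.IsSimple
    swap
    · -- `S ∼ E₁ × E₂`: `X ∼ E₁ × (E₂ × T)`
      obtain ⟨E₁, E₂, h₁, h₂, hYiso⟩ := exists_curve_prod_curve_isIsogenous_of_not_isSimple_surface hY2 hYs
      exact H E₁ (E₂.prod Z) h₁ (by rw [dim_prod]; omega) (not_isSimple_prod_of_dim_pos (by omega) (by omega))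
        (((isIsogenous_prod_assoc E₁ E₂ Z).symm'.trans (hYiso.prod (AbelianVariety.IsIsogenous.refl Z))).trans ⟨g, hg⟩)
    by_cases hZs : Z.IsSimple
    swap
    · -- `T ∼ E × S'`: `X ∼ E × (S × S')`
      obtain ⟨E, S', hE, hS'2, hZiso⟩ := exists_curve_prod_surface_isIsogenous_of_not_isSimple_threefold hZ3 hZs
      exact H E (Y.prod S') hE (by rw [dim_prod]; omega) (not_isSimple_prod_of_dim_pos (by omega) (by omega))
        (((isIsogenous_prod_leftComm E Y S').trans ((AbelianVariety.IsIsogenous.refl Y).prod hZiso)).trans ⟨g, hg⟩)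
    -- both simple
    exact (isStablyNondegenerate_simpleSurface_prod_threefold_of_not_isOfCMType_of hY2 hYs hZ3
      (fun h => hcm ((isOfCMType_iff_of_isIsogenous ⟨g, hg⟩).1 h))
      (fun hTc hT4 hYc => hST Y Z hY2 hYs hYc hZ3 hZs hTc hT4 ⟨g, hg⟩)).of_isIsogenous' ⟨g, hg⟩

/-- **MOONEN–ZARHIN Thm. 0.2 (4) FOR NON-SIMPLE FIVEFOLDS, the rows (5.10)–(5.11) displayed.** Let `X` be a non-simple
complex abelian fivefold with no simple isogeny factor of dimension `4`, outside the cases (e)/(f), and grant the two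
displayed rows (relative to `X`; they only concern products NOT of CM type). Then `X` is stably nondegenerate:
`B•(Xⁿ) = D•(Xⁿ)` for all `n`. `X` of CM type: the CorCM classification of CM abelian varieties of dimension `≤ 5`
(cases (a⁺) — which for `T` of dimension `3` is (e)/(f), an elliptic isogeny factor of a CM variety being of CM type, and
for `T` of dimension `4` is excluded by `h4` — and (b′), vacuous under `h4`); `X` not of CM type: the previous theorem.
[cite: MoonenZarhin1999LowDim, Thm. 0.2 (4) and §5 (5.6)–(5.11)] [cite: Milne1999, §2 p. 54] -/
theorem isStablyNondegenerate_of_dim_eq_five_of_not_isSimple_of (hX5 : X.dim = 5) (hX : ¬ X.IsSimple)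
    (h4 : ∀ F : AbelianVariety ℂ, F.IsSimple → F.dim = 4 → ¬ AVDominatedBy F X)
    (hna : ¬ ∃ E T : AbelianVariety ℂ, E.dim = 1 ∧ IsOfCMType E ∧ T.IsSimple ∧ T.dim = 3 ∧
      AVDominatedBy E X ∧ AVDominatedBy T X ∧ Nonempty (E.endAlgebra →+* T.endAlgebra))
    (hST : ∀ S T : AbelianVariety ℂ, S.dim = 2 → S.IsSimple → IsOfCMType S → T.dim = 3 → T.IsSimple →
      ¬ IsOfCMType T → ¬ HasNoTypeIVFactor T → AbelianVariety.IsIsogenous (S.prod T) X → IsStablyNondegenerate (S.prod T))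
    (hEET : ∀ E₁ E₂ T : AbelianVariety ℂ, E₁.dim = 1 → E₂.dim = 1 → IsOfCMType E₁ → IsOfCMType E₂ →
      ¬ AbelianVariety.IsIsogenous E₁ E₂ → T.dim = 3 → T.IsSimple → ¬ IsOfCMType T → ¬ HasNoTypeIVFactor T →
      IsEmpty (E₁.endAlgebra →+* T.endAlgebra) → IsEmpty (E₂.endAlgebra →+* T.endAlgebra) →
      AbelianVariety.IsIsogenous (E₁.prod (E₂.prod T)) X → IsStablyNondegenerate (E₁.prod (E₂.prod T))) :
    IsStablyNondegenerate X := by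
  by_cases hcm : IsOfCMType X
  · have hna' : ¬ ∃ E T : AbelianVariety ℂ, E.dim = 1 ∧ T.IsSimple ∧ (T.dim = 3 ∨ T.dim = 4) ∧
        AVDominatedBy E X ∧ AVDominatedBy T X ∧ Nonempty (E.endAlgebra →+* T.endAlgebra) := by
      rintro ⟨E, T, hE, hTs, hT34, hEX, hTX, hne⟩
      rcases hT34 with hT3 | hT4
      · exact hna ⟨E, T, hE, isOfCMType_of_avDominatedBy hcm hEX, hTs, hT3, hEX, hTX, hne⟩
      · exact h4 T hTs hT4 hTX
    intro N
    exact isDivisorGenerated_of_avDominatedBy_powSucc_of_isOfCMType_of_dim_le_five hcm hX5.le hna'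
      (fun F hFs hF4 hFX => absurd hFX (h4 F hFs hF4)) (AVDominatedBy.refl _)
  · exact isStablyNondegenerate_of_dim_eq_five_of_not_isSimple_of_not_isOfCMType_of hX5 hX hcm h4 hna hST hEET

/-- **The Hodge conjecture for every power `X^{N+1}` of every non-simple complex abelian fivefold without simple fourfold
factor, outside (e)/(f), given the two displayed rows** — unconditional otherwise (no HC_CM anywhere).
[cite: MoonenZarhin1999LowDim, Thm. 0.2 (4)] [cite: vanGeemen1994HodgeAV, Lemma 3.7 and §3.6] -/
theorem hodgeConjectureFor_powSucc_of_dim_eq_five_of_not_isSimple_of (hX5 : X.dim = 5) (hX : ¬ X.IsSimple)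
    (h4 : ∀ F : AbelianVariety ℂ, F.IsSimple → F.dim = 4 → ¬ AVDominatedBy F X)
    (hna : ¬ ∃ E T : AbelianVariety ℂ, E.dim = 1 ∧ IsOfCMType E ∧ T.IsSimple ∧ T.dim = 3 ∧
      AVDominatedBy E X ∧ AVDominatedBy T X ∧ Nonempty (E.endAlgebra →+* T.endAlgebra))
    (hST : ∀ S T : AbelianVariety ℂ, S.dim = 2 → S.IsSimple → IsOfCMType S → T.dim = 3 → T.IsSimple →
      ¬ IsOfCMType T → ¬ HasNoTypeIVFactor T → AbelianVariety.IsIsogenous (S.prod T) X → IsStablyNondegenerate (S.prod T))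
    (hEET : ∀ E₁ E₂ T : AbelianVariety ℂ, E₁.dim = 1 → E₂.dim = 1 → IsOfCMType E₁ → IsOfCMType E₂ →
      ¬ AbelianVariety.IsIsogenous E₁ E₂ → T.dim = 3 → T.IsSimple → ¬ IsOfCMType T → ¬ HasNoTypeIVFactor T →
      IsEmpty (E₁.endAlgebra →+* T.endAlgebra) → IsEmpty (E₂.endAlgebra →+* T.endAlgebra) →
      AbelianVariety.IsIsogenous (E₁.prod (E₂.prod T)) X → IsStablyNondegenerate (E₁.prod (E₂.prod T))) (N : ℕ) :
    HodgeConjectureFor (X.powSucc N).dim (X.powSucc N).X :=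
  (isStablyNondegenerate_of_dim_eq_five_of_not_isSimple_of hX5 hX h4 hna hST hEET).hodgeConjectureFor_powSucc N

/-! ### §4 Shapes on which no displayed row and no exceptional case can occur — no hypothesis at all -/

/-- **Every non-simple complex abelian fivefold all of whose simple isogeny factors have dimension `≤ 2` is stably
nondegenerate — UNCONDITIONAL, no further hypothesis** (cases (e), (f), (g), the displayed rows and `h4` all involve a
simple isogeny factor of dimension `3` or `4`). [cite: MoonenZarhin1999LowDim, Thm. 0.2 (4)] [cite: RamonMari2008, Prop. 2.18] -/
theorem isStablyNondegenerate_of_dim_eq_five_of_forall_factor_dim_le_two (hX5 : X.dim = 5) (hX : ¬ X.IsSimple)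
    (h : ∀ F : AbelianVariety ℂ, F.IsSimple → 3 ≤ F.dim → ¬ AVDominatedBy F X) : IsStablyNondegenerate X := by
  refine isStablyNondegenerate_of_dim_eq_five_of_not_isSimple_of hX5 hX (fun F hFs hF4 => h F hFs (by omega)) ?_ ?_ ?_
  · rintro ⟨-, T, -, -, hTs, hT3, -, hTX, -⟩
    exact h T hTs (by omega) hTX
  · intro S T _ _ _ hT3 hTs _ _ hrel
    obtain ⟨g, hg⟩ := hrel
    exact absurd ((avDominatedBy_prod_right S T).trans_isIsogeny_hom hg) (h T hTs (by omega))
  · intro E₁ E₂ T _ _ _ _ _ hT3 hTs _ _ _ _ hrel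
    obtain ⟨g, hg⟩ := hrel
    exact absurd (((avDominatedBy_prod_right E₂ T).trans (avDominatedBy_prod_right E₁ _)).trans_isIsogeny_hom hg)
      (h T hTs (by omega))

/-- **EVERY `E × (S₁ × S₂)` — an elliptic curve times two complex abelian surfaces — is stably nondegenerate:
UNCONDITIONAL, no hypothesis** (arbitrary `E`, `S₁`, `S₂`: CM or not, simple or not). In print for the product itself:
Ramón Marí 2008 Prop. 2.18 (`r = 3`); here with all powers, from Moonen–Zarhin's `B• = D•`.
[cite: MoonenZarhin1999LowDim, Thm. 0.2 (4)] [cite: RamonMari2008, Prop. 2.18] -/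
theorem isStablyNondegenerate_curve_prod_surface_prod_surface (hE : E.dim = 1) (h₁ : S₁.dim = 2) (h₂ : S₂.dim = 2) :
    IsStablyNondegenerate (E.prod (S₁.prod S₂)) :=
  isStablyNondegenerate_of_dim_eq_five_of_forall_factor_dim_le_two (by rw [dim_prod, dim_prod]; omega)
    (not_isSimple_prod_of_dim_pos (by omega) (by rw [dim_prod]; omega))
    (fun _ hFs hF3 => not_avDominatedBy_curve_prod_surface_prod_surface hE h₁ h₂ hFs hF3)

/-- **The Hodge conjecture for every power of every `E × (S₁ × S₂)` — UNCONDITIONAL.** [cite: MoonenZarhin1999LowDim, Thm. 0.2 (4)] [cite: RamonMari2008, Prop. 2.18] -/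
theorem hodgeConjectureFor_powSucc_curve_prod_surface_prod_surface (hE : E.dim = 1) (h₁ : S₁.dim = 2)
    (h₂ : S₂.dim = 2) (N : ℕ) :
    HodgeConjectureFor ((E.prod (S₁.prod S₂)).powSucc N).dim ((E.prod (S₁.prod S₂)).powSucc N).X :=
  (isStablyNondegenerate_curve_prod_surface_prod_surface hE h₁ h₂).hodgeConjectureFor_powSucc N

/-- **The Hodge conjecture for everything isogenous to a power of some `E × (S₁ × S₂)`** — in particular for every
complex abelian fivefold isogenous to a product of elliptic curves and abelian surfaces. [cite: MoonenZarhin1999LowDim, Thm. 0.2 (4)]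
[cite: RamonMari2008, Prop. 2.18] -/
theorem hodgeConjectureFor_of_isIsogenous_powSucc_curve_prod_surface_prod_surface (hE : E.dim = 1) (h₁ : S₁.dim = 2)
    (h₂ : S₂.dim = 2) {N : ℕ} (hY : AbelianVariety.IsIsogenous Y ((E.prod (S₁.prod S₂)).powSucc N)) :
    HodgeConjectureFor Y.dim Y.X :=
  (isStablyNondegenerate_curve_prod_surface_prod_surface hE h₁ h₂).hodgeConjectureFor_of_isIsogenous_powSucc hY

/-- **EVERY `E × (E' × T)` with `T` a NON-SIMPLE threefold is stably nondegenerate — UNCONDITIONAL** (`T ∼ E'' × S`, so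
`X ∼ E × ((E' × E'') × S)`, an elliptic curve times two surfaces). [cite: MoonenZarhin1999LowDim, Thm. 0.2 (4)] [cite: RamonMari2008, Prop. 2.18] -/
theorem isStablyNondegenerate_curve_prod_curve_prod_threefold_of_not_isSimple (hE : E.dim = 1) (hE' : E'.dim = 1)
    (hT3 : T.dim = 3) (hT : ¬ T.IsSimple) : IsStablyNondegenerate (E.prod (E'.prod T)) := by
  obtain ⟨E'', S, hE'', hS2, hTiso⟩ := exists_curve_prod_surface_isIsogenous_of_not_isSimple_threefold hT3 hT
  exact ((isStablyNondegenerate_curve_prod_surface_prod_surface (S₁ := E'.prod E'') hE (by rw [dim_prod]; omega)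
    hS2).of_isIsogenous' ((AbelianVariety.IsIsogenous.refl E).prod (isIsogenous_prod_assoc E' E'' S))).of_isIsogenous'
    ((AbelianVariety.IsIsogenous.refl E).prod ((AbelianVariety.IsIsogenous.refl E').prod hTiso))

/-- **EVERY `S × T` with `S` a surface and `T` a NON-SIMPLE threefold is stably nondegenerate — UNCONDITIONAL**
(`T ∼ E × S'`, so `S × T ∼ E × (S × S')`). [cite: MoonenZarhin1999LowDim, Thm. 0.2 (4)] [cite: RamonMari2008, Prop. 2.18] -/
theorem isStablyNondegenerate_surface_prod_threefold_of_not_isSimple (hS2 : S.dim = 2) (hT3 : T.dim = 3)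
    (hT : ¬ T.IsSimple) : IsStablyNondegenerate (S.prod T) := by
  obtain ⟨E, S', hE, hS'2, hTiso⟩ := exists_curve_prod_surface_isIsogenous_of_not_isSimple_threefold hT3 hT
  exact ((isStablyNondegenerate_curve_prod_surface_prod_surface hE hS2 hS'2).of_isIsogenous'
    (isIsogenous_prod_leftComm E S S')).of_isIsogenous' ((AbelianVariety.IsIsogenous.refl S).prod hTiso)

/-- **Every complex abelian variety of dimension `≤ 5` all of whose simple isogeny factors have dimension `≤ 2` is stably
nondegenerate — no case distinction at all** (dimension `≤ 3`: every variety, R20; `4`: gen 58's union, case (a) needing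
a simple threefold factor; `5`: the previous theorems). In print, for the products themselves: Ramón Marí 2008
Prop. 2.18 («`A_i` abelian varieties of dimension `1` or `2` ⟹ the Hodge conjecture holds for `A₁ × ⋯ × A_r`»), here for
total dimension `≤ 5` in the stronger form `B• = D•` on all powers. [cite: MoonenZarhin1999LowDim, Thm. 0.1 (4) and Thm. 0.2 (4)]
[cite: RamonMari2008, Prop. 2.18] -/
theorem isStablyNondegenerate_of_dim_le_five_of_forall_factor_dim_le_two (h0 : 0 < X.dim) (h5 : X.dim ≤ 5)
    (h : ∀ F : AbelianVariety ℂ, F.IsSimple → 3 ≤ F.dim → ¬ AVDominatedBy F X) : IsStablyNondegenerate X := by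
  have hX : 3 ≤ X.dim → ¬ X.IsSimple := fun h3 hs => h X hs h3 (AVDominatedBy.refl X)
  rcases Nat.lt_or_ge X.dim 4 with h3 | h4
  · exact isStablyNondegenerate_of_dim_pos_of_dim_le_three h0 (by omega)
  rcases Nat.lt_or_ge X.dim 5 with h4' | h5'
  · refine isStablyNondegenerate_of_dim_eq_four_of_not_isSimple (by omega) (hX (by omega)) ?_
    rintro ⟨-, T, -, hTs, hT3, -, hTX, -⟩
    exact h T hTs (by omega) hTX
  · exact isStablyNondegenerate_of_dim_eq_five_of_forall_factor_dim_le_two (by omega) (hX (by omega)) h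

/-- **The Hodge conjecture for all powers of such varieties — UNCONDITIONAL.** [cite: MoonenZarhin1999LowDim, Thm. 0.2 (4)] [cite: RamonMari2008, Prop. 2.18] -/
theorem hodgeConjectureFor_powSucc_of_dim_le_five_of_forall_factor_dim_le_two (h0 : 0 < X.dim) (h5 : X.dim ≤ 5)
    (h : ∀ F : AbelianVariety ℂ, F.IsSimple → 3 ≤ F.dim → ¬ AVDominatedBy F X) (N : ℕ) :
    HodgeConjectureFor (X.powSucc N).dim (X.powSucc N).X :=
  (isStablyNondegenerate_of_dim_le_five_of_forall_factor_dim_le_two h0 h5 h).hodgeConjectureFor_powSucc N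

/-- **`E × Z` for `E` an elliptic curve WITHOUT complex multiplication and `Z` ANY non-simple complex abelian fourfold
outside case (a) is stably nondegenerate — UNCONDITIONAL** («outside case (a)» as printed and relative to `E × Z`: no
CM elliptic curve `E₀` and simple threefold `T₀`, both isogeny factors, with `End⁰(E₀) ↪ End⁰(T₀)`; for `Z ∼ S₁ × S₂` or
`Z ∼ E' × T` with `T` non-simple it is vacuous). The displayed row cannot occur: its curves are of CM type, and `E`,
being non-CM, is not an isogeny factor of `E₁ × (E₂ × T₀)`. [cite: MoonenZarhin1999LowDim, Thm. 0.2 (4), §5 (5.6), (5.9), Lemma (3.4), Prop. (3.8)]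
[cite: Milne1999, §2 p. 54] -/
theorem isStablyNondegenerate_nonCMCurve_prod_fourfold_of_not_isSimple (hE : E.dim = 1) (hEcm : ¬ IsOfCMType E)
    (hZ4 : Z.dim = 4) (hZ : ¬ Z.IsSimple)
    (hna : ¬ ∃ E₀ T₀ : AbelianVariety ℂ, E₀.dim = 1 ∧ IsOfCMType E₀ ∧ T₀.IsSimple ∧ T₀.dim = 3 ∧
      AVDominatedBy E₀ (E.prod Z) ∧ AVDominatedBy T₀ (E.prod Z) ∧ Nonempty (E₀.endAlgebra →+* T₀.endAlgebra)) :
    IsStablyNondegenerate (E.prod Z) := by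
  refine isStablyNondegenerate_curve_prod_fourfold_of_not_isSimple_of_not_isOfCMType_of hE hZ4 hZ
    (not_isOfCMType_prod_left hEcm) hna ?_
  intro E₁ E₂ T₀ h₁ h₂ c₁ c₂ _ hT3 hTs _ _ _ _ hrel
  obtain ⟨g, hg⟩ := hrel
  -- `E` would be an isogeny factor of `E₁ × (E₂ × T₀)`, hence of `E₁`, hence isogenous to the CM curve `E₁`
  have hEW : AVDominatedBy E (E₁.prod (E₂.prod T₀)) := (SliceExhaustion.avDominatedBy_prod_left E Z).trans_isIsogeny_inv hg
  have hE₁ : AVDominatedBy E E₁ :=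
    avDominatedBy_left_of_forall_hom_eq_zero hEW (hom_prod_eq_zero_of_forall
      (hom_eq_zero_of_not_isOfCMType_of_isOfCMType_curves hE h₂ hEcm c₂)
      (fun f => hom_eq_zero_of_isSimple_of_dim_lt hTs (by omega) f))
  exact absurd ((isOfCMType_iff_of_isIsogenous (isIsogenous_of_isSimple_of_avDominatedBy (isSimple_of_dim_le_one hE.le)
    (isSimple_of_dim_le_one h₁.le) (by omega) hE₁)).2 c₁) hEcm

/-- **The Hodge conjecture for every power of such `E × Z` — UNCONDITIONAL.** [cite: MoonenZarhin1999LowDim, Thm. 0.2 (4)] -/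
theorem hodgeConjectureFor_powSucc_nonCMCurve_prod_fourfold_of_not_isSimple (hE : E.dim = 1) (hEcm : ¬ IsOfCMType E)
    (hZ4 : Z.dim = 4) (hZ : ¬ Z.IsSimple)
    (hna : ¬ ∃ E₀ T₀ : AbelianVariety ℂ, E₀.dim = 1 ∧ IsOfCMType E₀ ∧ T₀.IsSimple ∧ T₀.dim = 3 ∧
      AVDominatedBy E₀ (E.prod Z) ∧ AVDominatedBy T₀ (E.prod Z) ∧ Nonempty (E₀.endAlgebra →+* T₀.endAlgebra)) (N : ℕ) :
    HodgeConjectureFor ((E.prod Z).powSucc N).dim ((E.prod Z).powSucc N).X :=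
  (isStablyNondegenerate_nonCMCurve_prod_fourfold_of_not_isSimple hE hEcm hZ4 hZ hna).hodgeConjectureFor_powSucc N

/- **On path**: every target here is a CASE of the summit statement (`HodgeConjectureFor` of a smooth projective
variety; `Motives.AbelianVariety.isSmoothProjective_holds`). -/
example (h : ∀ ⦃n : ℕ⦄ ⦃Y : Literature.AlgebraicGeometry.Motives.SchemeOver ℂ⦄,
      Literature.AlgebraicGeometry.Motives.IsSmoothProjective n Y → HodgeConjectureFor n Y)
    (X : AbelianVariety ℂ) (N : ℕ) : HodgeConjectureFor (X.powSucc N).dim (X.powSucc N).X :=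
  h Literature.AlgebraicGeometry.Motives.AbelianVariety.isSmoothProjective_holds

end Summit.HodgeConjecture.Ring2.NonSimpleFivefolds
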